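import Summits.QuantumFields.YangMills.Theorems.UnitScaleTiltProp7HcoOfDivRecovery
import Summits.QuantumFields.YangMills.Theorems.UnitScaleTiltProp7TrueAvgBudgetOfRLegs
import Summits.QuantumFields.YangMills.Theorems.UnitScaleTiltProp7RLegsLinTowerRowsT3
import Summits.QuantumFields.YangMills.Theorems.UnitScaleTiltProp7DivRecoveryOfCollectedV2
import Summits.QuantumFields.YangMills.Theorems.UnitScaleTiltProp7DivRecoveryCollectedOfRowsV2
import Summits.QuantumFields.YangMills.Theorems.UnitScaleTiltProp7DivRecoveryPatchesToRowsV2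
import Summits.QuantumFields.YangMills.Theorems.UnitScaleTiltProp7DivRecoveryMemberCorePackaged
import Summits.QuantumFields.YangMills.Theorems.UnitScaleTiltProp7QprimeCombRightInverse
import Summits.QuantumFields.YangMills.Theorems.UnitScaleTiltProp7DivRecoveryCoarseRows
import Summits.QuantumFields.YangMills.Theorems.UnitScaleTiltProp7QH1OfSectors
import Summits.QuantumFields.YangMills.Theorems.UnitScaleTiltProp7QH1SectorRowsOfH
import Summits.QuantumFields.YangMills.Theorems.UnitScaleTiltProp7QH1SuRowOfRLegs
import Summits.QuantumFields.YangMills.Theorems.UnitScaleTiltProp7QH1CentralOfFlat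
import Summits.QuantumFields.YangMills.Theorems.UnitScaleTiltProp7QH1CentralRowFlat
import Summits.QuantumFields.YangMills.Theorems.UnitScaleTiltProp7DivRecoveryAssemblyPatches2
import HarnessLib

/-!
# Prop. 7 on T³ — LANE II TERMINAL KNIT: `hN06` (the N06 socket of the E′ growth side) FROM THE PATCH SCHEMA ALONE

Route `UnitScaleTilt`, crux «MinimiserStabilityRegPr» (stmt-QuantumFields-19200), EX stub `stub_existenceMinimalOrbit`, E′ growth side, lane II «divergence recovery at the
curved printed-regular member» (★★OWNER RULING №23).  Lane-II namer ★p1 (g19 door of record 09:50:37Z; g20 this knit).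

THE POINT.  The EX display (S36ᴸ ✓p721199 and successors) carries SEVEN lane-II rows `hEng, H, hH0, hHsplit, h𝔰𝔲, hcen, hPatch`.  Six of them are now theorems of the
tree BY NAME at the door functional `H := H_door` (`H_door F n K W f := c₀L·ℓ²·CURL_HS,W(f) + ‖D*_W f‖²`, ★px19 g6's letter, spelled as in ✓`Prop7QH1SectorRowsOfH.hH0_doorH`):
* (ENG) `hEng := Prop7TrueAvgBudgetOfRLegs.hEng_of_rlegs c₀ cB a₀ ha₀ rlegs_of_regPr` — ★px19 K2 over the curved (R-LEGS) row, itself UNCONDITIONAL by ★px18 g5's linear-response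
  tower `Prop7RLegsLinTowerRowsT3.rlegs_of_regPr` (F-9d (a)(b)(c)(d), ★routeR lane (II) cell rows, ★w4-20520 knit ✓p718441);
* `hH0 := hH0_doorH c₀`, `hHsplit := hHsplit_doorH c₀` (★px21 g8 ✓p722205);
* `h𝔰𝔲 := Prop7QH1SuRowOfRLegs.h𝔰𝔲_doorH_of_rlegs c₀ cB rlegs_of_regPr` (★px21 g8 FILE 3 over the same R-LEGS row);
* `hcen := Prop7QH1CentralOfFlat.hcen_doorH_of_flat c₀ cB (Prop7QH1CentralRowFlat.hcen_one c₀ cB)` (★px10 g5 ✓p722219 ∘ ★px22 g6 ✓p722080);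
* (B2a) `exists_smoothRightInverse_QprimeCombL2 c₀` (★px3 ✓p713560), (GN)∕(QN) `coarse_rows c₀` (★routeR-w3), the member core ✓`member_core_row_packaged` (★p1 g19 ✓p711805),
  the (QH1)♮ door ✓`hQH1_of_sectors` (★px21 g8 ✓p718170), and the (E1) plumbing with the patch-exponent floor `s₀` ✓`hRows_of_core_and_patches_v2` ∘ ✓`hColl_of_rows_v2` ∘
  ✓`hRec_of_collected_v2` (★px12 g9, ★★OWNER WORD 24) into the door ✓`Prop7HcoOfDivRecovery.hN06_of_divRecovery` (★px16 ✓p702330).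
So **`hN06` follows from ONE displayed hypothesis: the patch schema `hPatch` (v2, floor `s₀`) AT `H := H_door`** — the [I-9] member-geometry row of the PATCHES1∕PATCHES2 pens
(w1-19200 g16 `patch_rows`, px12 g9 `hPatch_of_patchRows`).  This file is that one-hypothesis theorem, by name; the EX namer may trade the seven lane-II rows for this one.

HONEST SCOPE.  A composition of landed theorems; `hPatch` is OPEN (named pens); nothing of (REC)∕EX `stub_existenceMinimalOrbit`∕the crux is proved here; the N06 PRINT rows
of the EX face are untouched.  YM₃ on T³ is rung R3 — NOT d = 4, NOT infinite volume, NOT a mass gap, NOT Clay.  THEOREMS ONLY (0 `def`, 0 `sorry`);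
`--supports stmt-QuantumFields-19200 --as helper`, count-neutral.
References: T. Bałaban, CMP **99** (1985) 389–434 [Balaban1985BackgroundPropagators] (Thm 3.11 p.416, (3.26) p.395, (3.10) p.392, (3.36)–(3.39) p.397); CMP **98** (1985) 17–51
[Balaban1985Averaging] ((110)–(112) p.34); CMP **102** (1985) 277–309 [Balaban1985Variational] ((6) p.278).
-/

set_option autoImplicit false

noncomputable section

open scoped InnerProductSpace ComplexConjugate BigOperators Matrix.Norms.L2Operator

namespace Summit.QuantumFields.YangMills.Theorems.Prop7HN06OfPatch

open Literature.MathematicalPhysics.QuantumFieldTheory.Balaban1983to89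
open Literature.MathematicalPhysics.QuantumFieldTheory.Balaban1983to89.T3ContinuumYM3Torus
open T3PrintedRegularMinimiser (RegPr)
open B9TorusCalculus (torusT)
open B9Eq39Adjoint (curl)
open B10Eq27TorusAxialLog (unitsField toUField)
open B11Eq103H1Complex (SiteL2K BondL2K laplaceAK)
open Summit.QuantumFields.YangMills.Theorems.Prop7SectET3Transport (periodsT3)
open Summit.QuantumFields.YangMills.Theorems.Prop7SectET3HilbertLetters (W₂ toL2 DL2 DstarL2 covLapSite)
open Summit.QuantumFields.YangMills.Theorems.Prop7SectET3WilsonHessian (DeltaEtaSlot)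
open Summit.QuantumFields.YangMills.Theorems.Prop7SectET3CombLetters (Qkc)
open Summit.QuantumFields.YangMills.Theorems.Prop7QprimeCombL2 (RcombL2)
open Summit.QuantumFields.YangMills.Theorems.Prop7HcoOfDivRecovery (hN06_of_divRecovery)
open Summit.QuantumFields.YangMills.Theorems.Prop7TrueAvgBudgetOfRLegs (hEng_of_rlegs)
open Summit.QuantumFields.YangMills.Theorems.Prop7RLegsLinTowerRowsT3 (rlegs_of_regPr)
open Summit.QuantumFields.YangMills.Theorems.Prop7DivRecoveryOfCollectedV2 (hRec_of_collected_v2)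
open Summit.QuantumFields.YangMills.Theorems.Prop7DivRecoveryCollectedOfRowsV2 (hColl_of_rows_v2)
open Summit.QuantumFields.YangMills.Theorems.Prop7DivRecoveryPatchesToRowsV2 (hRows_of_core_and_patches_v2)
open Summit.QuantumFields.YangMills.Theorems.Prop7DivRecoveryMemberCorePackaged (member_core_row_packaged)
open Summit.QuantumFields.YangMills.Theorems.Prop7QprimeCombRightInverse (exists_smoothRightInverse_QprimeCombL2)
open Summit.QuantumFields.YangMills.Theorems.Prop7DivRecoveryCoarseRows (coarse_rows)
open Summit.QuantumFields.YangMills.Theorems.Prop7QH1OfSectors (hQH1_of_sectors)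
open Summit.QuantumFields.YangMills.Theorems.Prop7QH1SectorRowsOfH (hHsplit_doorH hH0_doorH)
open Summit.QuantumFields.YangMills.Theorems.Prop7QH1SuRowOfRLegs (h𝔰𝔲_doorH_of_rlegs)
open Summit.QuantumFields.YangMills.Theorems.Prop7QH1CentralOfFlat (hcen_doorH_of_flat)
open Summit.QuantumFields.YangMills.Theorems.Prop7QH1CentralRowFlat (hcen_one)
open Summit.QuantumFields.YangMills.Theorems.Prop7DivRecoveryAssemblyPatches2 (hPatch_of_patchRows)
open B5Eq118OneStroke (iterBlockOf)
open B9Eq311L2Pairing (WL2)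
open T3LevelShift (bondShift)
open T3PrintedRegularOrbits (sites_eq)
open Summit.QuantumFields.YangMills.Theorems.Prop7SectET3HilbertLetters (toL2S frobEquiv)

variable (c₀ cB a₀ : ℕ → ℝ) [hc₀ : ∀ L : ℕ, Fact (0 < c₀ L)] [hcB : ∀ L : ℕ, Fact (0 < cB L)]

/-- ★★★ **LANE II TERMINAL KNIT — `hN06` FROM THE PATCH SCHEMA ALONE.**  For the weights `c₀ cB > 0` and the `Q*aQ` weight `a₀ > 0` (member-uniform at each `L`): the [I-9]
patch schema `hPatch` (v2: partition letters `Z ZE φ κs r`, eleven local budgets with a patch-exponent floor `s₀`, eight family rows; AT the door functional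
`H_door F n K W f := c₀L·ℓ²·CURL_HS,W(f) + ‖D*_W f‖²`) ⟹ `hN06`: at every printed-regular member `RegPr F n K e W`, `0 < e ≤ eN(L)`, the full-Landau operator
`laplaceAK(Δ^η_W, D_W, R_comb,W, D*_W, Q_k^c, (Q_k^c)*, a₀(c₀∕cB)ℓ³)` has a right inverse `G₀` with `‖G₀ f‖ ≤ B₀(L)·‖f‖`.  PROOF = the lane-II door of record by name:
`hN06_of_divRecovery (hEng_of_rlegs rlegs_of_regPr) (hRec_of_collected_v2 (hColl_of_rows_v2 (hRows_of_core_and_patches_v2 H_door (member_core_row_packaged (B2a) H_door hH0_doorH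
(hQH1_of_sectors H_door hH0_doorH hHsplit_doorH (h𝔰𝔲_doorH_of_rlegs rlegs_of_regPr) (hcen_doorH_of_flat hcen_one)) coarse_rows) hPatch)))`.
[cite: Balaban1985BackgroundPropagators, Thm 3.11 p.416, (3.26) p.395, (3.10) p.392, (3.36)-(3.39) p.397; Balaban1985Averaging, (110)-(112) p.34] -/
theorem hN06_of_patch (ha₀ : ∀ L, 1 < L → 0 < a₀ L)
    (hPatch : ∀ (L : ℕ), 1 < L → ∃ ν cL cMR cHM : ℝ, 0 ≤ ν ∧ 0 ≤ cL ∧ 0 ≤ cMR ∧ 0 ≤ cHM ∧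
      ∃ s₀ : ℕ, ∀ s : ℕ, s₀ ≤ s → ∃ cΦ cρCu cρN cKCu cKN cMAs cMCu cMe cHCu cHN eP : ℝ,
        0 ≤ cΦ ∧ 0 ≤ cρCu ∧ 0 ≤ cρN ∧ 0 ≤ cKCu ∧ 0 ≤ cKN ∧ 0 ≤ cMAs ∧ 0 ≤ cMCu ∧ 0 ≤ cMe ∧ 0 ≤ cHCu ∧ 0 ≤ cHN ∧ 0 < eP ∧
        ∀ (F : T3Family), F.L = L → ∀ (n K : ℕ) (hnK : n < K) (e : ℝ) (W : GaugeField (F.P K) 0 (Matrix.specialUnitaryGroup (Fin 2) ℂ)),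
          s < F.m + n → 0 < e → e ≤ eP → RegPr F n K e W →
          ∀ y : BondL2K ℂ 3 (periodsT3 F K) (c₀ F.L) W₂,
            ∃ (Z : Site (F.P K) 0 → SiteL2K ℂ 3 (periodsT3 F K) (c₀ F.L) W₂ →ₗ[ℂ] SiteL2K ℂ 3 (periodsT3 F K) (c₀ F.L) W₂)
              (ZE : Site (F.P K) 0 → BondL2K ℂ 3 (periodsT3 F K) (c₀ F.L) W₂ →ₗ[ℂ] BondL2K ℂ 3 (periodsT3 F K) (c₀ F.L) W₂)
              (φ κs : Site (F.P K) 0 → SiteL2K ℂ 3 (periodsT3 F K) (c₀ F.L) W₂) (r : Site (F.P K) 0 → BondL2K ℂ 3 (periodsT3 F K) (c₀ F.L) W₂)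
              (Ni Cui Asi ρi Φi Ki Li Mi Hρi HMi : Site (F.P K) 0 → ℝ),
              (∀ v, ∑ i, Z i v = v) ∧ (∀ f, ∑ i, ZE i f = f) ∧
              (∀ i, Z i (DstarL2 F n K (c₀ F.L) W y) = Z i (covLapSite F n K (c₀ F.L) W (φ i)) + Z i (κs i)) ∧
              (∀ i, ZE i (DL2 F n K (c₀ F.L) W (φ i)) = ZE i y - ZE i (r i)) ∧
              (∀ i, Φi i ≤ cΦ * ((F.L : ℝ) ^ s) ^ 2 * Ni i) ∧
              (∀ i, ρi i ≤ cρCu * Cui i + cρN * e * Ni i) ∧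
              (∀ i, Ki i ≤ cKCu * Cui i + cKN * e * Ni i) ∧
              (∀ i, Li i ≤ cL * ((F.L : ℝ) ^ s)⁻¹ ^ 2 * Ni i) ∧
              (∀ i, Mi i ≤ cMAs * Asi i + cMCu * Cui i + (cMR * ((F.L : ℝ) ^ s)⁻¹ ^ 2 + cMe * e) * Ni i) ∧
              (∀ i, Hρi i ≤ cHCu * Cui i + cHN * e * Ni i) ∧
              (∀ i, HMi i ≤ cHM * ((F.L : ℝ) ^ s)⁻¹ ^ 2 * Ni i) ∧
              (∑ i, Ni i ≤ ν * ‖y‖ ^ 2) ∧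
              (∑ i, Cui i ≤ ν * (RCLike.re ⟪y, DeltaEtaSlot F n K (c₀ F.L) W y⟫_ℂ + 1029 * e * ‖y‖ ^ 2)) ∧
              (∑ i, Asi i ≤ ν * ((c₀ F.L / cB F.L) * ((F.L : ℝ) ^ (K - n)) ^ 3 * ‖Qkc F n K hnK.le (c₀ F.L) (cB F.L) W y‖ ^ 2)) ∧
              (‖∑ i, ZE i (r i)‖ ^ 2 ≤ ν * ∑ i, ρi i) ∧
              (‖∑ i, (DL2 F n K (c₀ F.L) W (Z i (φ i)) - ZE i (DL2 F n K (c₀ F.L) W (φ i)))‖ ^ 2 ≤ ν * ∑ i, Mi i) ∧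
              ((fun (F : T3Family) (n K : ℕ) (W : GaugeField (F.P K) 0 (Matrix.specialUnitaryGroup (Fin 2) ℂ)) (f : BondL2K ℂ 3 (periodsT3 F K) (c₀ F.L) W₂) =>
                c₀ F.L * ((F.L : ℝ) ^ (K - n)) ^ 2 * (∑ x : Site (F.P K) 0, ∑ μ : Fin (F.P K).d, ∑ ν : Fin (F.P K).d,
                (if μ < ν then ∑ j : Fin 2, ∑ k : Fin 2,
                ‖(curl (torusT (F.P K) 0) (fun κ z => unitsField (toUField W) ⟨z, κ⟩) (fun κ z => (toL2 F K (c₀ F.L)).symm f ⟨z, κ⟩) μ ν x) j k‖ ^ 2 else 0))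
                + ‖DstarL2 F n K (c₀ F.L) W f‖ ^ 2)
                  F n K W (∑ i, ZE i (r i)) ≤ ν * ∑ i, Hρi i) ∧
              ((fun (F : T3Family) (n K : ℕ) (W : GaugeField (F.P K) 0 (Matrix.specialUnitaryGroup (Fin 2) ℂ)) (f : BondL2K ℂ 3 (periodsT3 F K) (c₀ F.L) W₂) =>
                c₀ F.L * ((F.L : ℝ) ^ (K - n)) ^ 2 * (∑ x : Site (F.P K) 0, ∑ μ : Fin (F.P K).d, ∑ ν : Fin (F.P K).d,
                (if μ < ν then ∑ j : Fin 2, ∑ k : Fin 2,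
                ‖(curl (torusT (F.P K) 0) (fun κ z => unitsField (toUField W) ⟨z, κ⟩) (fun κ z => (toL2 F K (c₀ F.L)).symm f ⟨z, κ⟩) μ ν x) j k‖ ^ 2 else 0))
                + ‖DstarL2 F n K (c₀ F.L) W f‖ ^ 2)
                  F n K W (∑ i, (DL2 F n K (c₀ F.L) W (Z i (φ i)) - ZE i (DL2 F n K (c₀ F.L) W (φ i)))) ≤ ν * ∑ i, HMi i) ∧
              (‖∑ i, (covLapSite F n K (c₀ F.L) W (Z i (φ i)) - Z i (covLapSite F n K (c₀ F.L) W (φ i)))‖ ^ 2 ≤ ν * ∑ i, Li i) ∧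
              (‖∑ i, Z i (κs i)‖ ^ 2 ≤ ν * ∑ i, Ki i) ∧
              (‖∑ i, Z i (φ i)‖ ^ 2 ≤ ν * ∑ i, Φi i)) :
    ∀ (L : ℕ), 1 < L → ∃ B₀ eN : ℝ, 0 < B₀ ∧ 0 < eN ∧
      ∀ (F : T3Family), F.L = L → ∀ (n K : ℕ) (hnK : n < K) (e : ℝ) (W : GaugeField (F.P K) 0 (Matrix.specialUnitaryGroup (Fin 2) ℂ)),
        0 < e → e ≤ eN → RegPr F n K e W →
        ∃ G₀ : BondL2K ℂ 3 (periodsT3 F K) (c₀ F.L) W₂ →ₗ[ℂ] BondL2K ℂ 3 (periodsT3 F K) (c₀ F.L) W₂,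
          laplaceAK (DeltaEtaSlot F n K (c₀ F.L) W) (DL2 F n K (c₀ F.L) W) (RcombL2 F n K (c₀ F.L) W) (DstarL2 F n K (c₀ F.L) W)
              (Qkc F n K hnK.le (c₀ F.L) (cB F.L) W) (LinearMap.adjoint (Qkc F n K hnK.le (c₀ F.L) (cB F.L) W))
              (((a₀ F.L * (c₀ F.L / cB F.L) * ((F.L : ℝ) ^ (K - n)) ^ 3 : ℝ) : ℂ)) ∘ₗ G₀ = LinearMap.id ∧
          ∀ f, ‖G₀ f‖ ≤ B₀ * ‖f‖ :=
    hN06_of_divRecovery c₀ cB a₀ ha₀ (hEng_of_rlegs c₀ cB a₀ ha₀ rlegs_of_regPr)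
    (hRec_of_collected_v2 c₀ cB a₀ ha₀ (hColl_of_rows_v2 c₀ cB a₀ ha₀ (hRows_of_core_and_patches_v2 c₀ cB
      (fun (F : T3Family) (n K : ℕ) (W : GaugeField (F.P K) 0 (Matrix.specialUnitaryGroup (Fin 2) ℂ)) (f : BondL2K ℂ 3 (periodsT3 F K) (c₀ F.L) W₂) =>
        c₀ F.L * ((F.L : ℝ) ^ (K - n)) ^ 2 * (∑ x : Site (F.P K) 0, ∑ μ : Fin (F.P K).d, ∑ ν : Fin (F.P K).d,
        (if μ < ν then ∑ j : Fin 2, ∑ k : Fin 2,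
        ‖(curl (torusT (F.P K) 0) (fun κ z => unitsField (toUField W) ⟨z, κ⟩) (fun κ z => (toL2 F K (c₀ F.L)).symm f ⟨z, κ⟩) μ ν x) j k‖ ^ 2 else 0))
        + ‖DstarL2 F n K (c₀ F.L) W f‖ ^ 2)
      (member_core_row_packaged c₀ cB (exists_smoothRightInverse_QprimeCombL2 c₀)
        (fun (F : T3Family) (n K : ℕ) (W : GaugeField (F.P K) 0 (Matrix.specialUnitaryGroup (Fin 2) ℂ)) (f : BondL2K ℂ 3 (periodsT3 F K) (c₀ F.L) W₂) =>
        c₀ F.L * ((F.L : ℝ) ^ (K - n)) ^ 2 * (∑ x : Site (F.P K) 0, ∑ μ : Fin (F.P K).d, ∑ ν : Fin (F.P K).d,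
        (if μ < ν then ∑ j : Fin 2, ∑ k : Fin 2,
        ‖(curl (torusT (F.P K) 0) (fun κ z => unitsField (toUField W) ⟨z, κ⟩) (fun κ z => (toL2 F K (c₀ F.L)).symm f ⟨z, κ⟩) μ ν x) j k‖ ^ 2 else 0))
        + ‖DstarL2 F n K (c₀ F.L) W f‖ ^ 2)
        (hH0_doorH c₀)
        (hQH1_of_sectors c₀ cB
          (fun (F : T3Family) (n K : ℕ) (W : GaugeField (F.P K) 0 (Matrix.specialUnitaryGroup (Fin 2) ℂ)) (f : BondL2K ℂ 3 (periodsT3 F K) (c₀ F.L) W₂) =>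
        c₀ F.L * ((F.L : ℝ) ^ (K - n)) ^ 2 * (∑ x : Site (F.P K) 0, ∑ μ : Fin (F.P K).d, ∑ ν : Fin (F.P K).d,
        (if μ < ν then ∑ j : Fin 2, ∑ k : Fin 2,
        ‖(curl (torusT (F.P K) 0) (fun κ z => unitsField (toUField W) ⟨z, κ⟩) (fun κ z => (toL2 F K (c₀ F.L)).symm f ⟨z, κ⟩) μ ν x) j k‖ ^ 2 else 0))
        + ‖DstarL2 F n K (c₀ F.L) W f‖ ^ 2)
          (hH0_doorH c₀) (hHsplit_doorH c₀) (h𝔰𝔲_doorH_of_rlegs c₀ cB rlegs_of_regPr) (hcen_doorH_of_flat c₀ cB (hcen_one c₀ cB)))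
        (coarse_rows c₀)) hPatch)))

/-- ★★★ **LANE II TERMINAL KNIT, ONE LEVEL DEEPER — `hN06` FROM THE CLOSED PER-PATCH SCHEMA `hP1`** (★px12 g9's PATCHES2 ✓`hPatch_of_patchRows`: the grid package,
the family sums and the resource multiplicities are theorems; `hP1` = what PATCHES1's `patch_rows` (w1-19200 g16) delivers at ONE patch of ONE member, (QH1)♮ supplied
by name at `H := H_door`).  `hN06_of_patchRows hP1 := hN06_of_patch (hPatch_of_patchRows hP1)`.
[cite: Balaban1985BackgroundPropagators, Thm 3.11 p.416, (3.100) pp.413-414, (3.19)-(3.26) pp.393-395] -/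
theorem hN06_of_patchRows (ha₀ : ∀ L, 1 < L → 0 < a₀ L)
    (hP1 : ∀ (L : ℕ), 1 < L → ∃ cL cMR cHM : ℝ, 0 ≤ cL ∧ 0 ≤ cMR ∧ 0 ≤ cHM ∧ ∃ s₀ : ℕ, ∀ s : ℕ, s₀ ≤ s →
      ∃ cΦ cρCu cρN cKCu cKN cMAs cMCu cMe cHCu cHN eP : ℝ,
        0 ≤ cΦ ∧ 0 ≤ cρCu ∧ 0 ≤ cρN ∧ 0 ≤ cKCu ∧ 0 ≤ cKN ∧ 0 ≤ cMAs ∧ 0 ≤ cMCu ∧ 0 ≤ cMe ∧ 0 ≤ cHCu ∧ 0 ≤ cHN ∧ 0 < eP ∧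
        ∀ (F : T3Family), F.L = L → ∀ (n K : ℕ) (hnK : n < K) (e : ℝ) (W : GaugeField (F.P K) 0 (Matrix.specialUnitaryGroup (Fin 2) ℂ)),
          s < F.m + n → 0 < e → e ≤ eP → RegPr F n K e W →
          ∀ (y : BondL2K ℂ 3 (periodsT3 F K) (c₀ F.L) W₂),
          ∀ g ∈ (Fintype.piFinset fun _ : Fin 3 => Finset.range (2 * F.L ^ (F.m + n - s))),
          ∀ (ζc : Site (F.P K) 0 → ℝ) (Z : SiteL2K ℂ 3 (periodsT3 F K) (c₀ F.L) W₂ →ₗ[ℂ] SiteL2K ℂ 3 (periodsT3 F K) (c₀ F.L) W₂)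
            (ZE : BondL2K ℂ 3 (periodsT3 F K) (c₀ F.L) W₂ →ₗ[ℂ] BondL2K ℂ 3 (periodsT3 F K) (c₀ F.L) W₂),
            (∀ x, 0 ≤ ζc x ∧ ζc x ≤ 1) →
            (∀ x, ζc x ≠ 0 → ∀ κ : Fin 3, min (x κ - ((g κ * (F.L ^ s * F.L ^ (K - n)) : ℕ) : ZMod ((F.P K).sitesPerDir 0))).val (((g κ * (F.L ^ s * F.L ^ (K - n)) : ℕ) : ZMod ((F.P K).sitesPerDir 0)) - x κ).val < F.L ^ s * F.L ^ (K - n)) →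
            (∀ x (μ : Fin 3), |ζc (x.shift μ) - ζc x| ≤ 3 / 2 / ((F.L : ℝ) ^ s * (F.L : ℝ) ^ (K - n)) ∧ |ζc (x.unshift μ) - ζc x| ≤ 3 / 2 / ((F.L : ℝ) ^ s * (F.L : ℝ) ^ (K - n))) →
            (∀ x (μ : Fin 3), |ζc (x.shift μ) + ζc (x.unshift μ) - 2 * ζc x| ≤ 6 / ((F.L : ℝ) ^ s * (F.L : ℝ) ^ (K - n)) ^ 2) →
            (∀ φ x, (toL2S F K (c₀ F.L)).symm (Z φ) x = ζc x • (toL2S F K (c₀ F.L)).symm φ x) →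
            (∀ f b, (toL2 F K (c₀ F.L)).symm (ZE f) b = ζc b.src • (toL2 F K (c₀ F.L)).symm f b) →
            ∃ (φ κs : SiteL2K ℂ 3 (periodsT3 F K) (c₀ F.L) W₂) (r : BondL2K ℂ 3 (periodsT3 F K) (c₀ F.L) W₂) (N Cu As : ℝ),
              Z (DstarL2 F n K (c₀ F.L) W y) = Z (covLapSite F n K (c₀ F.L) W φ) + Z κs ∧
              ZE (DL2 F n K (c₀ F.L) W φ) = ZE y - ZE r ∧
              ‖φ‖ ^ 2 ≤ cΦ * ((F.L : ℝ) ^ s) ^ 2 * N ∧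
              ‖r‖ ^ 2 ≤ cρCu * Cu + cρN * e * N ∧
              ‖Z κs‖ ^ 2 ≤ cKCu * Cu + cKN * e * N ∧
              ‖covLapSite F n K (c₀ F.L) W (Z φ) - Z (covLapSite F n K (c₀ F.L) W φ)‖ ^ 2 ≤ cL * ((F.L : ℝ) ^ s)⁻¹ ^ 2 * N ∧
              ‖DL2 F n K (c₀ F.L) W (Z φ) - ZE (DL2 F n K (c₀ F.L) W φ)‖ ^ 2
                ≤ cMAs * As + cMCu * Cu + (cMR * ((F.L : ℝ) ^ s)⁻¹ ^ 2 + cMe * e) * N ∧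
              (c₀ F.L * ((F.L : ℝ) ^ (K - n)) ^ 2 * (∑ x : Site (F.P K) 0, ∑ μ : Fin (F.P K).d, ∑ ν : Fin (F.P K).d, (if μ < ν then ∑ j : Fin 2, ∑ k : Fin 2, ‖(curl (torusT (F.P K) 0) (fun κ z => unitsField (toUField W) ⟨z, κ⟩) (fun κ z => (toL2 F K (c₀ F.L)).symm (ZE r) ⟨z, κ⟩) μ ν x) j k‖ ^ 2 else 0)) + ‖DstarL2 F n K (c₀ F.L) W (ZE r)‖ ^ 2)
                ≤ cHCu * Cu + cHN * e * N ∧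
              (c₀ F.L * ((F.L : ℝ) ^ (K - n)) ^ 2 * (∑ x : Site (F.P K) 0, ∑ μ : Fin (F.P K).d, ∑ ν : Fin (F.P K).d, (if μ < ν then ∑ j : Fin 2, ∑ k : Fin 2, ‖(curl (torusT (F.P K) 0) (fun κ z => unitsField (toUField W) ⟨z, κ⟩) (fun κ z => (toL2 F K (c₀ F.L)).symm (DL2 F n K (c₀ F.L) W (Z φ) - ZE (DL2 F n K (c₀ F.L) W φ)) ⟨z, κ⟩) μ ν x) j k‖ ^ 2 else 0)) + ‖DstarL2 F n K (c₀ F.L) W (DL2 F n K (c₀ F.L) W (Z φ) - ZE (DL2 F n K (c₀ F.L) W φ))‖ ^ 2)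
                ≤ cHM * ((F.L : ℝ) ^ s)⁻¹ ^ 2 * N ∧
              N ≤ ∑ b ∈ Finset.univ.filter (fun b : PBond (F.P K) 0 => ∀ κ : Fin 3,
                  min ((iterBlockOf (K - n) b.src) κ - ((g κ * F.L ^ s : ℕ) : ZMod ((F.P K).sitesPerDir (K - n)))).val
                    ((((g κ * F.L ^ s : ℕ) : ZMod ((F.P K).sitesPerDir (K - n)))) - (iterBlockOf (K - n) b.src) κ).val ≤ 2 * F.L ^ s + 2), c₀ F.L * ‖(frobEquiv.symm ((toL2 F K (c₀ F.L)).symm y b) : W₂)‖ ^ 2 ∧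
              Cu ≤ ∑ x ∈ Finset.univ.filter (fun x : Site (F.P K) 0 => ∀ κ : Fin 3,
                  min ((iterBlockOf (K - n) x) κ - ((g κ * F.L ^ s : ℕ) : ZMod ((F.P K).sitesPerDir (K - n)))).val
                    ((((g κ * F.L ^ s : ℕ) : ZMod ((F.P K).sitesPerDir (K - n)))) - (iterBlockOf (K - n) x) κ).val ≤ 2 * F.L ^ s + 2),
                c₀ F.L * ((F.L : ℝ) ^ (K - n)) ^ 2 * ∑ μ : Fin (F.P K).d, ∑ ν : Fin (F.P K).d, (if μ < ν then ∑ j : Fin 2, ∑ k : Fin 2,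
                  ‖(curl (torusT (F.P K) 0) (fun κ z => unitsField (toUField W) ⟨z, κ⟩) (fun κ z => (toL2 F K (c₀ F.L)).symm y ⟨z, κ⟩) μ ν x) j k‖ ^ 2 else 0) ∧
              As ≤ ∑ c ∈ Finset.univ.filter (fun c : PBond (F.P K) (K - n) => ∀ κ : Fin 3,
                  min ((c.src) κ - ((g κ * F.L ^ s : ℕ) : ZMod ((F.P K).sitesPerDir (K - n)))).val
                    ((((g κ * F.L ^ s : ℕ) : ZMod ((F.P K).sitesPerDir (K - n)))) - (c.src) κ).val ≤ 2 * F.L ^ s + 2),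
                (c₀ F.L / cB F.L) * ((F.L : ℝ) ^ (K - n)) ^ 3 * (cB F.L * ‖WL2.equiv ℂ (fun _ : PBond (F.P n) 0 => cB F.L) W₂
                  (Qkc F n K hnK.le (c₀ F.L) (cB F.L) W y) ((bondShift (sites_eq F n K hnK.le)).symm c)‖ ^ 2)) :
    ∀ (L : ℕ), 1 < L → ∃ B₀ eN : ℝ, 0 < B₀ ∧ 0 < eN ∧
      ∀ (F : T3Family), F.L = L → ∀ (n K : ℕ) (hnK : n < K) (e : ℝ) (W : GaugeField (F.P K) 0 (Matrix.specialUnitaryGroup (Fin 2) ℂ)),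
        0 < e → e ≤ eN → RegPr F n K e W →
        ∃ G₀ : BondL2K ℂ 3 (periodsT3 F K) (c₀ F.L) W₂ →ₗ[ℂ] BondL2K ℂ 3 (periodsT3 F K) (c₀ F.L) W₂,
          laplaceAK (DeltaEtaSlot F n K (c₀ F.L) W) (DL2 F n K (c₀ F.L) W) (RcombL2 F n K (c₀ F.L) W) (DstarL2 F n K (c₀ F.L) W)
              (Qkc F n K hnK.le (c₀ F.L) (cB F.L) W) (LinearMap.adjoint (Qkc F n K hnK.le (c₀ F.L) (cB F.L) W))
              (((a₀ F.L * (c₀ F.L / cB F.L) * ((F.L : ℝ) ^ (K - n)) ^ 3 : ℝ) : ℂ)) ∘ₗ G₀ = LinearMap.id ∧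
          ∀ f, ‖G₀ f‖ ≤ B₀ * ‖f‖ :=
  hN06_of_patch c₀ cB a₀ ha₀ (hPatch_of_patchRows c₀ cB hP1)

end Summit.QuantumFields.YangMills.Theorems.Prop7HN06OfPatch

end
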